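import Mathlib

/-!
# Katz data form a graded ring (helper for stub `stub_katzGain`)

Route `CapacityClassicality`, crux `IntegralOverconvergentIsCongruence` (item stmt-Langlands-8457),
line `Sketch`; helper file for `CapacityClassicalityIntegralOverconvergentIsCongruenceStubKatzGain`.

A *Katz datum* of weight `w`, rate `r`, constant `C'` on `Γ₁(N)` for a complex `q`-series `F` is a
family `c' : ℕ → ℂ⟦q⟧` with `c'ᵢ` the `q`-expansion of a classical form of weight `w + i(p-1)` on
`Γ₁(N)`, `ι`-adic bounds `‖ι⁻¹ aₙ(c'ᵢ)‖ ≤ C' p^{-ri}`, and `∑ᵢ c'ᵢ E_{p-1}^{-i} = F` coefficientwise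
along `ι⁻¹` (as `HasSum`s in `ℚ̄_p`).  Packaging a datum as its generating series
`Φ = ∑ᵢ c'ᵢ Tⁱ ∈ ℂ⟦q⟧⟦T⟧`, each of the three conditions is stable under products
(`katzFormFamily_mul`, `katzNormFamily_mul`, `katzSumFamily_mul`: the Cauchy product, the
ultrametric inequality, and `HasSum.mul_of_nonarchimedean` in the non-complete but nonarchimedean
field `ℚ̄_p`, regrouped along the finite fibres `i + j = n`), hence under powers and finite sums
of equal weight; a single form gives a one-term datum (`katzFormFamily_C`, …).  The file ends with
the elementary real-number packaging of the constants of `stub_katzGain` (`katz_gain_bound`).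
-/

set_option linter.dupNamespace false -- project-wide option (lakefile weak.linter.dupNamespace); `Summit.Langlands.Langlands` is the mandated namespace

open scoped MatrixGroups Manifold Topology
open UpperHalfPlane CongruenceSubgroup Metric PowerSeries

noncomputable section

namespace Summit.Langlands.Langlands.Theorems.CapacityClassicality

/-! ## Form families: `coeff i Φ` is the `q`-expansion of a form of weight `w + i d` on `Γ₁(N)` -/

/-- A finite sum of `q`-expansions of modular forms of weight `κ` on `Γ₁(N)` is the `q`-expansion
of a modular form of weight `κ`. -/
theorem katz_exists_form_sum {N : ℕ} {κ : ℤ} {α : Type*} (s : Finset α)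
    (f : α → PowerSeries ℂ)
    (h : ∀ a ∈ s, ∃ G : ModularForm (CongruenceSubgroup.Gamma1 N) κ, f a = qExpansion 1 ⇑G) :
    ∃ G : ModularForm (CongruenceSubgroup.Gamma1 N) κ, ∑ a ∈ s, f a = qExpansion 1 ⇑G := by
  classical
  induction s using Finset.induction_on with
  | empty =>
    exact ⟨0, by rw [Finset.sum_empty, ModularForm.coe_zero, UpperHalfPlane.qExpansion_zero]⟩
  | insert a s ha ih =>
    obtain ⟨G₁, hG₁⟩ := h a (Finset.mem_insert_self a s)
    obtain ⟨G₂, hG₂⟩ := ih fun b hb ↦ h b (Finset.mem_insert_of_mem hb)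
    refine ⟨G₁ + G₂, ?_⟩
    rw [Finset.sum_insert ha, hG₁, hG₂, ModularForm.coe_add,
      ModularForm.qExpansion_add one_pos (by simp) G₁ G₂]

/-- Form families are stable under the Cauchy product (products of forms, weights add). -/
theorem katzFormFamily_mul {N : ℕ} (d : ℕ) {w₁ w₂ : ℤ} {Φ₁ Φ₂ : PowerSeries (PowerSeries ℂ)}
    (h₁ : ∀ i : ℕ, ∃ G : ModularForm (CongruenceSubgroup.Gamma1 N) (w₁ + i * d),
      coeff i Φ₁ = qExpansion 1 ⇑G)
    (h₂ : ∀ i : ℕ, ∃ G : ModularForm (CongruenceSubgroup.Gamma1 N) (w₂ + i * d),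
      coeff i Φ₂ = qExpansion 1 ⇑G) :
    ∀ i : ℕ, ∃ G : ModularForm (CongruenceSubgroup.Gamma1 N) (w₁ + w₂ + i * d),
      coeff i (Φ₁ * Φ₂) = qExpansion 1 ⇑G := by
  intro n
  rw [PowerSeries.coeff_mul]
  refine katz_exists_form_sum _ _ fun ij hij ↦ ?_
  rw [Finset.HasAntidiagonal.mem_antidiagonal] at hij
  obtain ⟨G, hG⟩ := h₁ ij.1
  obtain ⟨H, hH⟩ := h₂ ij.2
  refine ⟨(G.mul H).mcast (by rw [← hij]; push_cast; ring), ?_⟩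
  rw [hG, hH, ModularForm.qExpansion_mcast, ModularForm.qExpansion_mul one_pos (by simp) G H]

/-- The one-term family of a single form of weight `w`. -/
theorem katzFormFamily_C {N : ℕ} (d : ℕ) {w : ℤ}
    (G₀ : ModularForm (CongruenceSubgroup.Gamma1 N) w) :
    ∀ i : ℕ, ∃ G : ModularForm (CongruenceSubgroup.Gamma1 N) (w + i * d),
      coeff i (C (qExpansion 1 ⇑G₀)) = qExpansion 1 ⇑G := by
  intro i
  rcases Nat.eq_zero_or_pos i with rfl | hi
  · exact ⟨G₀.mcast (by simp), by simp⟩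
  · exact ⟨0, by simp [PowerSeries.coeff_C, hi.ne', UpperHalfPlane.qExpansion_zero]⟩

/-- Transport of a form family along an equality of weights. -/
theorem katzFormFamily_congr {N : ℕ} (d : ℕ) {w w' : ℤ} {Φ : PowerSeries (PowerSeries ℂ)}
    (hw : w = w')
    (h : ∀ i : ℕ, ∃ G : ModularForm (CongruenceSubgroup.Gamma1 N) (w + i * d),
      coeff i Φ = qExpansion 1 ⇑G) :
    ∀ i : ℕ, ∃ G : ModularForm (CongruenceSubgroup.Gamma1 N) (w' + i * d),
      coeff i Φ = qExpansion 1 ⇑G := by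
  subst hw
  exact h

/-- Form families are stable under powers. -/
theorem katzFormFamily_pow {N : ℕ} (d : ℕ) {w : ℤ} {Φ : PowerSeries (PowerSeries ℂ)}
    (h : ∀ i : ℕ, ∃ G : ModularForm (CongruenceSubgroup.Gamma1 N) (w + i * d),
      coeff i Φ = qExpansion 1 ⇑G) :
    ∀ j i : ℕ, ∃ G : ModularForm (CongruenceSubgroup.Gamma1 N) (j * w + i * d),
      coeff i (Φ ^ j) = qExpansion 1 ⇑G := by
  intro j
  induction j with
  | zero =>
    rw [pow_zero, ← map_one (PowerSeries.C (R := PowerSeries ℂ)),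
      ← ModularForm.qExpansion_one (Γ := CongruenceSubgroup.Gamma1 N) (h := 1)]
    exact katzFormFamily_congr d (by simp) (katzFormFamily_C d 1)
  | succ j ih =>
    rw [pow_succ]
    exact katzFormFamily_congr d (by push_cast; ring) (katzFormFamily_mul d ih h)

/-- Form families of equal weight are stable under finite sums. -/
theorem katzFormFamily_sum {N : ℕ} (d : ℕ) {w : ℤ} {α : Type*} (s : Finset α)
    (Φ : α → PowerSeries (PowerSeries ℂ))
    (h : ∀ a ∈ s, ∀ i : ℕ, ∃ G : ModularForm (CongruenceSubgroup.Gamma1 N) (w + i * d),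
      coeff i (Φ a) = qExpansion 1 ⇑G) :
    ∀ i : ℕ, ∃ G : ModularForm (CongruenceSubgroup.Gamma1 N) (w + i * d),
      coeff i (∑ a ∈ s, Φ a) = qExpansion 1 ⇑G := by
  intro i
  rw [map_sum]
  exact katz_exists_form_sum s _ fun a ha ↦ h a ha i

/-! ## Norm families: `‖ι⁻¹ aₙ(coeff i Φ)‖ ≤ C' p^{-ri}` -/

/-- Ultrametric bound for `ι⁻¹` of a finite sum. -/
theorem katz_norm_symm_sum_le {p : ℕ} [Fact p.Prime] (ι : PadicAlgCl p ≃+* ℂ) {α : Type*}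
    (s : Finset α) (f : α → ℂ) {B : ℝ} (hB : 0 ≤ B) (h : ∀ a ∈ s, ‖ι.symm (f a)‖ ≤ B) :
    ‖ι.symm (∑ a ∈ s, f a)‖ ≤ B := by
  rw [map_sum]
  exact IsUltrametricDist.norm_sum_le_of_forall_le_of_nonneg hB h

/-- Norm families are stable under the Cauchy product (constants multiply). -/
theorem katzNormFamily_mul {p : ℕ} [Fact p.Prime] (ι : PadicAlgCl p ≃+* ℂ) (r : ℝ)
    {C₁ C₂ : ℝ} {Φ₁ Φ₂ : PowerSeries (PowerSeries ℂ)}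
    (h₁ : ∀ i n : ℕ, ‖ι.symm (coeff n (coeff i Φ₁))‖ ≤ C₁ * (p : ℝ) ^ (-(r * i)))
    (h₂ : ∀ i n : ℕ, ‖ι.symm (coeff n (coeff i Φ₂))‖ ≤ C₂ * (p : ℝ) ^ (-(r * i))) :
    ∀ i n : ℕ, ‖ι.symm (coeff n (coeff i (Φ₁ * Φ₂)))‖ ≤ C₁ * C₂ * (p : ℝ) ^ (-(r * i)) := by
  have hp0 : (0 : ℝ) < p := by exact_mod_cast (Fact.out : p.Prime).pos
  have hC₁ : 0 ≤ C₁ := by simpa using (norm_nonneg _).trans (h₁ 0 0)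
  have hC₂ : 0 ≤ C₂ := by simpa using (norm_nonneg _).trans (h₂ 0 0)
  intro i n
  have h0 : 0 ≤ C₁ * C₂ * (p : ℝ) ^ (-(r * i)) := by positivity
  rw [PowerSeries.coeff_mul, map_sum]
  refine katz_norm_symm_sum_le ι _ _ h0 fun ij hij ↦ ?_
  rw [Finset.HasAntidiagonal.mem_antidiagonal] at hij
  rw [PowerSeries.coeff_mul]
  refine katz_norm_symm_sum_le ι _ _ h0 fun ab _ ↦ ?_
  rw [map_mul, norm_mul]
  calc ‖ι.symm (coeff ab.1 (coeff ij.1 Φ₁))‖ * ‖ι.symm (coeff ab.2 (coeff ij.2 Φ₂))‖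
      ≤ C₁ * (p : ℝ) ^ (-(r * ij.1)) * (C₂ * (p : ℝ) ^ (-(r * ij.2))) :=
        mul_le_mul (h₁ _ _) (h₂ _ _) (norm_nonneg _) (by positivity)
    _ = C₁ * C₂ * (p : ℝ) ^ (-(r * i)) := by
        rw [← hij, Nat.cast_add,
          show -(r * ((ij.1 : ℝ) + ij.2)) = -(r * ij.1) + -(r * ij.2) by ring, Real.rpow_add hp0]
        ring

/-- The one-term norm family of an `ι`-adically integral series. -/
theorem katzNormFamily_C {p : ℕ} [Fact p.Prime] (ι : PadicAlgCl p ≃+* ℂ) (r : ℝ)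
    {X : PowerSeries ℂ} (hX : ∀ n, ‖ι.symm (coeff n X)‖ ≤ 1) :
    ∀ i n : ℕ, ‖ι.symm (coeff n (coeff i (C X)))‖ ≤ 1 * (p : ℝ) ^ (-(r * i)) := by
  intro i n
  rw [PowerSeries.coeff_C]
  split_ifs with hi
  · subst hi
    simpa using hX n
  · have : (0 : ℝ) ≤ (p : ℝ) ^ (-(r * i)) := Real.rpow_nonneg (Nat.cast_nonneg p) _
    simpa using this

/-- Enlarging the constant of a norm family. -/
theorem katzNormFamily_mono {p : ℕ} [Fact p.Prime] (ι : PadicAlgCl p ≃+* ℂ) (r : ℝ)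
    {C' C'' : ℝ} {Φ : PowerSeries (PowerSeries ℂ)} (hle : C' ≤ C'')
    (h : ∀ i n : ℕ, ‖ι.symm (coeff n (coeff i Φ))‖ ≤ C' * (p : ℝ) ^ (-(r * i))) :
    ∀ i n : ℕ, ‖ι.symm (coeff n (coeff i Φ))‖ ≤ C'' * (p : ℝ) ^ (-(r * i)) := fun i n ↦
  (h i n).trans (mul_le_mul_of_nonneg_right hle (Real.rpow_nonneg (Nat.cast_nonneg p) _))

/-- Norm families are stable under powers. -/
theorem katzNormFamily_pow {p : ℕ} [Fact p.Prime] (ι : PadicAlgCl p ≃+* ℂ) (r : ℝ) {C' : ℝ}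
    {Φ : PowerSeries (PowerSeries ℂ)}
    (h : ∀ i n : ℕ, ‖ι.symm (coeff n (coeff i Φ))‖ ≤ C' * (p : ℝ) ^ (-(r * i))) :
    ∀ j i n : ℕ, ‖ι.symm (coeff n (coeff i (Φ ^ j)))‖ ≤ C' ^ j * (p : ℝ) ^ (-(r * i)) := by
  intro j
  induction j with
  | zero =>
    simp only [pow_zero]
    rw [← map_one (PowerSeries.C (R := PowerSeries ℂ))]
    exact katzNormFamily_C ι r fun n ↦ by
      rw [PowerSeries.coeff_one]
      split_ifs <;> simp
  | succ j ih =>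
    simp only [pow_succ]
    exact katzNormFamily_mul ι r ih h

/-- Norm families with a common constant are stable under finite sums. -/
theorem katzNormFamily_sum {p : ℕ} [Fact p.Prime] (ι : PadicAlgCl p ≃+* ℂ) (r : ℝ) {C' : ℝ}
    (hC' : 0 ≤ C') {α : Type*} (s : Finset α) (Φ : α → PowerSeries (PowerSeries ℂ))
    (h : ∀ a ∈ s, ∀ i n : ℕ, ‖ι.symm (coeff n (coeff i (Φ a)))‖ ≤ C' * (p : ℝ) ^ (-(r * i))) :
    ∀ i n : ℕ, ‖ι.symm (coeff n (coeff i (∑ a ∈ s, Φ a)))‖ ≤ C' * (p : ℝ) ^ (-(r * i)) := by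
  intro i n
  rw [map_sum, map_sum]
  exact katz_norm_symm_sum_le ι s _ (mul_nonneg hC' (Real.rpow_nonneg (Nat.cast_nonneg p) _))
    fun a ha ↦ h a ha i n

/-! ## Sum families: `∑ᵢ ι⁻¹ aₙ(coeff i Φ · Qⁱ) = ι⁻¹ aₙ(F)` -/

/-- Sum families are stable under the Cauchy product (`HasSum.mul_of_nonarchimedean` in the
nonarchimedean field `ℚ̄_p`, regrouped along the finite fibres `i + j = n`). -/
theorem katzSumFamily_mul {p : ℕ} [Fact p.Prime] (ι : PadicAlgCl p ≃+* ℂ) (Q : PowerSeries ℂ)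
    {F₁ F₂ : PowerSeries ℂ} {Φ₁ Φ₂ : PowerSeries (PowerSeries ℂ)}
    (h₁ : ∀ n : ℕ, HasSum (fun i : ℕ ↦ ι.symm (coeff n (coeff i Φ₁ * Q ^ i)))
      (ι.symm (coeff n F₁)))
    (h₂ : ∀ n : ℕ, HasSum (fun i : ℕ ↦ ι.symm (coeff n (coeff i Φ₂ * Q ^ i)))
      (ι.symm (coeff n F₂))) :
    ∀ n : ℕ, HasSum (fun i : ℕ ↦ ι.symm (coeff n (coeff i (Φ₁ * Φ₂) * Q ^ i)))
      (ι.symm (coeff n (F₁ * F₂))) := by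
  haveI : NonarchimedeanRing (PadicAlgCl p) := ⟨NonarchimedeanAddGroup.is_nonarchimedean⟩
  intro m
  -- the Cauchy product over `ℕ × ℕ`
  have hprod : HasSum (fun ij : ℕ × ℕ ↦
      ι.symm (coeff m ((coeff ij.1 Φ₁ * Q ^ ij.1) * (coeff ij.2 Φ₂ * Q ^ ij.2))))
      (ι.symm (coeff m (F₁ * F₂))) := by
    have h := hasSum_sum fun (ab : ℕ × ℕ) (_ : ab ∈ Finset.HasAntidiagonal.antidiagonal m) ↦
      (h₁ ab.1).mul_of_nonarchimedean (h₂ ab.2)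
    rw [PowerSeries.coeff_mul m F₁ F₂, map_sum]
    simp_rw [map_mul]
    refine h.congr_fun fun ij ↦ ?_
    rw [PowerSeries.coeff_mul, map_sum]
    simp_rw [map_mul]
  -- regroup along `i + j = n`
  have hsig := (Finset.HasAntidiagonal.sigmaAntidiagonalEquivProd.hasSum_iff.mpr hprod).sigma
    fun n ↦ hasSum_fintype (L := SummationFilter.unconditional _) _
  refine hsig.congr_fun fun n ↦ ?_
  simp only [Function.comp_def, Finset.HasAntidiagonal.sigmaAntidiagonalEquivProd_apply]
  rw [Finset.sum_coe_sort (Finset.HasAntidiagonal.antidiagonal n) fun ij : ℕ × ℕ ↦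
    ι.symm (coeff m ((coeff ij.1 Φ₁ * Q ^ ij.1) * (coeff ij.2 Φ₂ * Q ^ ij.2))),
    PowerSeries.coeff_mul n Φ₁ Φ₂, Finset.sum_mul, map_sum, map_sum]
  refine Finset.sum_congr rfl fun ij hij ↦ ?_
  rw [Finset.HasAntidiagonal.mem_antidiagonal] at hij
  rw [← hij, pow_add]
  exact congrArg (fun S ↦ ι.symm (coeff m S)) (by ring)

/-- The one-term sum family. -/
theorem katzSumFamily_C {p : ℕ} [Fact p.Prime] (ι : PadicAlgCl p ≃+* ℂ) (Q X : PowerSeries ℂ) :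
    ∀ n : ℕ, HasSum (fun i : ℕ ↦ ι.symm (coeff n (coeff i (C X) * Q ^ i)))
      (ι.symm (coeff n X)) := by
  intro n
  have := hasSum_single (f := fun i : ℕ ↦ ι.symm (coeff n (coeff i (C X) * Q ^ i))) 0
    fun i hi ↦ by simp [PowerSeries.coeff_C, hi]
  simpa using this

/-- Sum families are stable under powers. -/
theorem katzSumFamily_pow {p : ℕ} [Fact p.Prime] (ι : PadicAlgCl p ≃+* ℂ) (Q : PowerSeries ℂ)
    {F : PowerSeries ℂ} {Φ : PowerSeries (PowerSeries ℂ)}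
    (h : ∀ n : ℕ, HasSum (fun i : ℕ ↦ ι.symm (coeff n (coeff i Φ * Q ^ i)))
      (ι.symm (coeff n F))) :
    ∀ j n : ℕ, HasSum (fun i : ℕ ↦ ι.symm (coeff n (coeff i (Φ ^ j) * Q ^ i)))
      (ι.symm (coeff n (F ^ j))) := by
  intro j
  induction j with
  | zero =>
    simp only [pow_zero]
    rw [← map_one (PowerSeries.C (R := PowerSeries ℂ))]
    exact katzSumFamily_C ι Q 1
  | succ j ih =>
    simp only [pow_succ]
    exact katzSumFamily_mul ι Q ih h

/-- Sum families are stable under finite sums. -/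
theorem katzSumFamily_sum {p : ℕ} [Fact p.Prime] (ι : PadicAlgCl p ≃+* ℂ) (Q : PowerSeries ℂ)
    {α : Type*} (s : Finset α) (F : α → PowerSeries ℂ) (Φ : α → PowerSeries (PowerSeries ℂ))
    (h : ∀ a ∈ s, ∀ n : ℕ, HasSum (fun i : ℕ ↦ ι.symm (coeff n (coeff i (Φ a) * Q ^ i)))
      (ι.symm (coeff n (F a)))) :
    ∀ n : ℕ, HasSum (fun i : ℕ ↦ ι.symm (coeff n (coeff i (∑ a ∈ s, Φ a) * Q ^ i)))
      (ι.symm (coeff n (∑ a ∈ s, F a))) := by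
  intro n
  have := hasSum_sum fun a (ha : a ∈ s) ↦ h a ha n
  simp only [map_sum, Finset.sum_mul] at this ⊢
  exact this

/-! ## Packaging of the constants -/

/-- `x^{e_A} (c x^{e_B})ⁿ ((x^{e_R})⁻¹)^M = cⁿ x^{e_A + n e_B - M e_R}` for `x > 0`. -/
theorem katz_real_packaging {x : ℝ} (hx : 0 < x) (c eA eB eR : ℝ) (n M : ℕ) :
    x ^ eA * (c * x ^ eB) ^ n * (x ^ eR)⁻¹ ^ M = c ^ n * x ^ (eA + eB * n + -(eR * M)) := by
  rw [Real.rpow_add hx, Real.rpow_add hx, Real.rpow_neg hx.le, mul_pow, inv_pow,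
    Real.rpow_mul hx.le, Real.rpow_natCast, Real.rpow_mul hx.le, Real.rpow_natCast]
  ring

/-- The Katz–Sturm bound for a datum of weight `12 D₁ + 12 k⁺ D₂` and constant `C₀^{12 D₂}` is at
most `A B^{D₁+D₂} R⁻¹^M` for the constants of `stub_katzGain`. -/
theorem katz_gain_bound {x r μ C₀ kp : ℝ} (hx : 1 < x) (hr : 0 < r) (hμ : 1 ≤ μ)
    (hC₀ : 1 ≤ C₀) (hkp : 0 ≤ kp) (D₁ D₂ M : ℕ) :
    (C₀ ^ 12) ^ D₂ * x ^ (r / (x - 1) * (12 * D₁ + 12 * kp * D₂ + 12 - 12 * ((M : ℝ) + 1) / μ)) ≤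
      x ^ (r / (x - 1) * (12 - 12 / μ)) *
        (C₀ ^ 12 * x ^ (12 * r * (kp + 1) / (x - 1))) ^ (D₁ + D₂) *
        (x ^ (12 * r / ((x - 1) * μ)))⁻¹ ^ M := by
  have hx0 : 0 < x := by linarith
  have hd : 0 < x - 1 := by linarith
  have hμ0 : 0 < μ := by linarith
  have hC₀0 : 0 < C₀ := by linarith
  rw [katz_real_packaging hx0]
  refine mul_le_mul (pow_le_pow_right₀ (one_le_pow₀ hC₀) (by omega))
    (Real.rpow_le_rpow_of_exponent_le hx.le ?_) (by positivity) (by positivity)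
  rw [← sub_nonneg]
  have : r / (x - 1) * (12 - 12 / μ) + 12 * r * (kp + 1) / (x - 1) * ((D₁ + D₂ : ℕ) : ℝ) +
      -(12 * r / ((x - 1) * μ) * M) -
      r / (x - 1) * (12 * D₁ + 12 * kp * D₂ + 12 - 12 * ((M : ℝ) + 1) / μ) =
      r / (x - 1) * (12 * kp * D₁ + 12 * D₂) := by
    push_cast
    field_simp
    ring
  rw [this]
  positivity

end Summit.Langlands.Langlands.Theorems.CapacityClassicality

end
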